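import Summits.ResolutionOfSingularities.ResolutionOfSingularities.Theorems.EquisingularLiftEquisingularLiftNatConeRoundCartier
import Literature.AlgebraicGeometry.Resolution.SpreadRestrict
import Literature.AlgebraicGeometry.Resolution.AlterationsProofs
import HarnessLib

/-!
# [OURS · L1 W4.5(b) · EL♮(3)] rung TOWER supplier — THE CONE-ROUND BRICK, part 2: the new cut `V(𝓔' ⊔ 𝒦')` IS the old centre
# `V(𝓔 ⊔ 𝒦)` (a scheme isomorphism over the blow-up), with the regularity and flatness transports

Crux chain w45b (cell `res-hironaka`, slot W4.5(b)), working crux **EL♮** = stmt-ResolutionOfSingularities-20038, child **EL♮(3)** =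
stmt-ResolutionOfSingularities-20148, route EquisingularLift, rung TOWER (`…NatTowerDefs` p541504; TOWER-INST p542565, res-L1-w45b-lead-2).
Clauses (3), (3a), (3b) of res-L1-w45b-lead-2's CONE-ROUND clause shape (2026-08-27T15:36:16Z); part 1 = `…NatConeRoundCartier` (p545368:
`coneRound` = clauses (1), (2), (3′)). Hand res-D-pv-051. HONEST FRAMING: OURS; NOT a statement of any manuscript; AI-written, weaker than
expert review. No `sorry`; standard axioms. DEF-FREE. `--supports stmt-ResolutionOfSingularities-20148 --as helper`.

* `isPullback_id_lift_subschemeι` — for `J ≤ I`, `V(I)` is the fibre product `V(I) ×_X V(J)` (a mono absorbs);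
* `exists_iso_subscheme_comap_subschemeι_of_le` — hence `V(I|_{V(J)}) ≅ V(I)` over `X` (sub-subscheme repackaging);
* **`coneRound_centreIso`** — clause (3): with `C := 𝓔 ⊔ 𝒦`, `𝓔' := C.comap τ`, `𝒦' := strictTransformIdeal τ C 𝒦`, an iso
  `e' : V(𝓔' ⊔ 𝒦') ≅ V(𝓔 ⊔ 𝒦)` with `e'.hom ≫ (𝓔 ⊔ 𝒦).subschemeι = (𝓔' ⊔ 𝒦').subschemeι ≫ τ` — from part 1's (3′)
  `(𝓔' ⊔ 𝒦')|_{V(𝒦')} = e^*((𝓔 ⊔ 𝒦)|_{V(𝒦)})` by two cartesian squares (sub-subscheme; base change along the iso `e`);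
* `coneRound_isRegular` — clause (3a): `V(𝓔 ⊔ 𝒦)` regular ⇒ `V(𝓔' ⊔ 𝒦')` regular;
* `coneRound_flat` — clause (3b): `V(𝓔 ⊔ 𝒦) → X → B` flat ⇒ `V(𝓔' ⊔ 𝒦') → X' → X → B` flat, any base `B`.

References: Görtz–Wedhorn I, Prop. 13.91 (1), (13.19) [GortzWedhorn2020]; tree `…NatConeRoundCartier` (p545368), `SpreadRestrict`
(`isPullback_subschemeMap`), `AlterationsProofs` (`Scheme.IsRegular.of_isOpenImmersion`).
-/

set_option linter.dupNamespace false -- mandated namespace `Summit.<Summit>.<Problem>` of this single-conjunct summit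

noncomputable section

open CategoryTheory CategoryTheory.Limits AlgebraicGeometry TopologicalSpace
open Literature.AlgebraicGeometry.Resolution
open AlgebraicGeometry.Scheme.IdealSheafData

universe u

namespace Summit.ResolutionOfSingularities.ResolutionOfSingularities.Cruxes.EquisingularLiftNat.Sections

/-! ## Sub-subschemes: `V(I|_{V(J)}) ≅ V(I)` for `J ≤ I` -/

section SubSub

variable {X : Scheme.{u}} {I J : X.IdealSheafData}

/-- For `J ≤ I` the inclusion `V(I) ↪ X` factors through `V(J)`. [folklore] -/
theorem ker_subschemeι_le_of_le (hJI : J ≤ I) : J.subschemeι.ker ≤ I.subschemeι.ker := by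
  rw [Scheme.IdealSheafData.ker_subschemeι, Scheme.IdealSheafData.ker_subschemeι]; exact hJI

/-- **A mono absorbs**: for `J ≤ I`, the square `(𝟙 : V(I) → V(I), V(I) → V(J); V(I) ↪ X, V(J) ↪ X)` is cartesian — `V(I)` is
the fibre product `V(I) ×_X V(J)`. [folklore] -/
theorem isPullback_id_lift_subschemeι (hJI : J ≤ I) :
    IsPullback (𝟙 I.subscheme) (IsClosedImmersion.lift J.subschemeι I.subschemeι (ker_subschemeι_le_of_le hJI))
      I.subschemeι J.subschemeι :=
  IsPullback.of_horiz_isIso_mono ⟨by rw [Category.id_comp, IsClosedImmersion.lift_fac]⟩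

/-- **Sub-subscheme repackaging**: for `J ≤ I`, the closed subscheme `V(I|_{V(J)})` of `V(J)` is `V(I)`, compatibly with the
inclusions into `X`. [folklore] -/
theorem exists_iso_subscheme_comap_subschemeι_of_le (hJI : J ≤ I) :
    ∃ e : (I.comap J.subschemeι).subscheme ≅ I.subscheme,
      e.hom ≫ I.subschemeι = (I.comap J.subschemeι).subschemeι ≫ J.subschemeι := by
  refine ⟨(isPullback_subschemeMap J.subschemeι I).isoIsPullback _ _ (isPullback_id_lift_subschemeι hJI), ?_⟩
  have h := (isPullback_subschemeMap J.subschemeι I).isoIsPullback_hom_fst _ _ (isPullback_id_lift_subschemeι hJI)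
  rw [Category.comp_id] at h
  rw [h, subschemeMap_subschemeι]

end SubSub

/-! ## Clause (3): the new cut is the old centre -/

section Centre

variable {X X' : Scheme.{u}} [IsLocallyNoetherian X] (𝓔 𝒦 : X.IdealSheafData) {τ : X' ⟶ X}

/-- **CONE-ROUND, clause (3): the new cut `V(𝓔' ⊔ 𝒦')` is the old centre `V(𝓔 ⊔ 𝒦)`, as schemes over the blow-up.** With
`C := 𝓔 ⊔ 𝒦`, `𝓔' := C.comap τ`, `𝒦' := strictTransformIdeal τ C 𝒦`: an iso `e' : V(𝓔' ⊔ 𝒦') ≅ V(𝓔 ⊔ 𝒦)` with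
`e'.hom ≫ (𝓔 ⊔ 𝒦).subschemeι = (𝓔' ⊔ 𝒦').subschemeι ≫ τ`. [cite: GortzWedhorn2020, Prop. 13.91 (1) and (13.19), p. 413–414]
[OURS · L1 W4.5b] rung TOWER supplier; NOT a statement of the manuscript. -/
theorem coneRound_centreIso (hE𝒦 : IsEffectiveCartier (𝓔.comap 𝒦.subschemeι)) (hτ : IsBlowup τ (𝓔 ⊔ 𝒦)) :
    ∃ e' : ((𝓔 ⊔ 𝒦).comap τ ⊔ strictTransformIdeal τ (𝓔 ⊔ 𝒦) 𝒦).subscheme ≅ (𝓔 ⊔ 𝒦).subscheme,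
      e'.hom ≫ (𝓔 ⊔ 𝒦).subschemeι = ((𝓔 ⊔ 𝒦).comap τ ⊔ strictTransformIdeal τ (𝓔 ⊔ 𝒦) 𝒦).subschemeι ≫ τ := by
  obtain ⟨e, he, -, h3⟩ := coneRound 𝓔 𝒦 hE𝒦 hτ
  -- (i) sub-subscheme upstairs: `V(C'|_{V(𝒦')}) ≅ V(C')`
  obtain ⟨e₁, he₁⟩ := exists_iso_subscheme_comap_subschemeι_of_le
    (I := (𝓔 ⊔ 𝒦).comap τ ⊔ strictTransformIdeal τ (𝓔 ⊔ 𝒦) 𝒦) (J := strictTransformIdeal τ (𝓔 ⊔ 𝒦) 𝒦) le_sup_right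
  -- (ii) base change along the iso `e`: `V(C'|_{V(𝒦')}) = V(e^*(C|_{V(𝒦)})) ≅ V(C|_{V(𝒦)})`
  obtain ⟨m, hm⟩ : ∃ m : (((𝓔 ⊔ 𝒦).comap τ ⊔ strictTransformIdeal τ (𝓔 ⊔ 𝒦) 𝒦).comap
        (strictTransformIdeal τ (𝓔 ⊔ 𝒦) 𝒦).subschemeι).subscheme ⟶ ((𝓔 ⊔ 𝒦).comap 𝒦.subschemeι).subscheme,
      IsPullback m (((𝓔 ⊔ 𝒦).comap τ ⊔ strictTransformIdeal τ (𝓔 ⊔ 𝒦) 𝒦).comap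
        (strictTransformIdeal τ (𝓔 ⊔ 𝒦) 𝒦).subschemeι).subschemeι ((𝓔 ⊔ 𝒦).comap 𝒦.subschemeι).subschemeι e.hom := by
    rw [h3]
    exact ⟨_, isPullback_subschemeMap e.hom ((𝓔 ⊔ 𝒦).comap 𝒦.subschemeι)⟩
  haveI : IsIso m := hm.isIso_fst_of_isIso
  -- (iii) sub-subscheme downstairs: `V(C|_{V(𝒦)}) ≅ V(C)`
  obtain ⟨e₀, he₀⟩ := exists_iso_subscheme_comap_subschemeι_of_le (I := 𝓔 ⊔ 𝒦) (J := 𝒦) le_sup_right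
  refine ⟨e₁.symm ≪≫ asIso m ≪≫ e₀, ?_⟩
  rw [Iso.trans_hom, Iso.trans_hom, Iso.symm_hom, asIso_hom, Category.assoc, Category.assoc, he₀,
    reassoc_of% hm.w, he,
    ← Category.assoc ((((𝓔 ⊔ 𝒦).comap τ ⊔ strictTransformIdeal τ (𝓔 ⊔ 𝒦) 𝒦).comap
      (strictTransformIdeal τ (𝓔 ⊔ 𝒦) 𝒦).subschemeι).subschemeι), ← he₁, Category.assoc, e₁.inv_hom_id_assoc]

/-- **CONE-ROUND, clause (3a): regularity transports** — if the old centre `V(𝓔 ⊔ 𝒦)` is regular, so is the new cut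
`V(𝓔' ⊔ 𝒦')`. [cite: GortzWedhorn2020, (13.19) p. 414] -/
theorem coneRound_isRegular (hE𝒦 : IsEffectiveCartier (𝓔.comap 𝒦.subschemeι)) (hτ : IsBlowup τ (𝓔 ⊔ 𝒦))
    (hreg : Scheme.IsRegular (𝓔 ⊔ 𝒦).subscheme) :
    Scheme.IsRegular ((𝓔 ⊔ 𝒦).comap τ ⊔ strictTransformIdeal τ (𝓔 ⊔ 𝒦) 𝒦).subscheme := by
  obtain ⟨e', -⟩ := coneRound_centreIso 𝓔 𝒦 hE𝒦 hτ
  exact Scheme.IsRegular.of_isOpenImmersion e'.hom hreg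

/-- **CONE-ROUND, clause (3b): flatness over any base transports** — for any `q : X → B`, if `V(𝓔 ⊔ 𝒦) → X → B` is flat, so
is `V(𝓔' ⊔ 𝒦') → X' → X → B`. [cite: GortzWedhorn2020, (13.19) p. 414] -/
theorem coneRound_flat (hE𝒦 : IsEffectiveCartier (𝓔.comap 𝒦.subschemeι)) (hτ : IsBlowup τ (𝓔 ⊔ 𝒦)) {B : Scheme.{u}}
    (q : X ⟶ B) (hflat : Flat ((𝓔 ⊔ 𝒦).subschemeι ≫ q)) :
    Flat (((𝓔 ⊔ 𝒦).comap τ ⊔ strictTransformIdeal τ (𝓔 ⊔ 𝒦) 𝒦).subschemeι ≫ τ ≫ q) := by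
  obtain ⟨e', he'⟩ := coneRound_centreIso 𝓔 𝒦 hE𝒦 hτ
  have h : ((𝓔 ⊔ 𝒦).comap τ ⊔ strictTransformIdeal τ (𝓔 ⊔ 𝒦) 𝒦).subschemeι ≫ τ ≫ q = e'.hom ≫ ((𝓔 ⊔ 𝒦).subschemeι ≫ q) := by
    rw [← Category.assoc, ← he', Category.assoc]
  rw [h]
  haveI := hflat
  infer_instance

end Centre

end Summit.ResolutionOfSingularities.ResolutionOfSingularities.Cruxes.EquisingularLiftNat.Sections

end
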